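import Summits.NavierStokesRegularity.NavierStokesRegularity.Theses.RellichScar
import Summits.NavierStokesRegularity.NavierStokesRegularity.Theorems.ScarRigidity.Negative.LogicAndLoadBearing
import Literature.Analysis.FluidPDE.TypeIAncientMild
import Literature.Analysis.FluidPDE.ParasiticSlabFlow
import HarnessLib

/-!
# `ScarRigidity` — line `finite-energy-log-convexity`, stub `stub_farFieldOfScar`
# (crux stmt-NavierStokesRegularity-11717, route RellichScar)

**S1b — the scar makes the twins polynomially close off the apex.** If `V₁, V₂` are jointly smooth
representatives (on the open slab `(-∞, 0) × ℝ³`) of `u₁, u₂`, with the time-derivative bounds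
`‖∂ₜVᵢ(t, x)‖ ≤ Lᵢ / (‖x‖ + √(-t))³`, and `u₁, u₂` have the same scar (`SameScar u₁ u₂`: the
ess-sup of `u₁ - u₂` on `(-δ, 0) × K` tends to `0` with `δ` for every compact `K ∌ 0`), then
`‖V₁(t, x) − V₂(t, x)‖ ≤ (L₁ + L₂)(−t)/‖x‖³` for all `t < 0`, `x ≠ 0`.

Proof. (1) The scar read on the continuous representatives (`tendsto_sub_of_sameScar_ae`): on the
open box `(−δ, 0) × B(x₀, ‖x₀‖/2)` the a.e. bound `‖V₁ − V₂‖ ≤ ε` (transferred from `u₁ − u₂` through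
the a.e. equalities on the slab) holds everywhere, because a nonempty open superlevel set would have
positive Lebesgue measure (`norm_le_of_ae_of_continuousOn`); hence `V₁(s, x₀) − V₂(s, x₀) → 0` as
`s ↑ 0`. (2) The time line `g(s) = V₁(s, x₀) − V₂(s, x₀)` is differentiable on `s < 0` with
`‖g'(s)‖ ≤ (L₁ + L₂)/(‖x₀‖ + √(−s))³ ≤ (L₁ + L₂)/‖x₀‖³`; the mean value inequality on `(−∞, 0)` and
the limit `s ↑ 0` give the claim. Mathlib only (`Convex.norm_image_sub_le_of_norm_hasDerivWithin_le`,
`IsOpen.measure_pos`, `ae_le_eLpNormEssSup`). The sibling line `moment-conditioned-rellich` has the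
`SameScar V₁ V₂` version of step (1) (`tendsto_sub_of_sameScar`,
Theorems/RellichScarScarRigidityFarFieldAllOrders); it is re-proved here in the form needed (scar on
`u₁, u₂`, a.e. representatives) so that this line's import closure stays independent of the sibling's.
-/

noncomputable section

open Set Filter Function MeasureTheory Metric TopologicalSpace
open scoped Topology ENNReal NNReal InnerProductSpace RealInnerProductSpace
open Literature.Analysis.FluidPDE
open Summit.NavierStokesRegularity.NavierStokesRegularity.Theses.RellichScar
open Summit.NavierStokesRegularity.NavierStokesRegularity.Theorems.ScarRigidity.Negative

set_option linter.dupNamespace false -- D-0017: `Summit.<S>.<S>.…` repeats the summit name by design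

namespace Summit.NavierStokesRegularity.NavierStokesRegularity.Theorems.RellichScarScarRigidity

/-- Physical space. -/
local notation "ℝ³" => EuclideanSpace ℝ (Fin 3)

/-- The open backward slab `(-∞,0) × ℝ³` (time first), as in the route file. -/
local notation "𝕊" => Literature.Analysis.FluidPDE.slab (EuclideanSpace ℝ (Fin 3)) (Set.Iio (0 : ℝ)) isOpen_Iio

/-! ## From an a.e. bound to an everywhere bound, for continuous functions on open sets -/

/-- On an open set `U ⊆ ℝ × ℝ³`, a function continuous on `U` whose norm is a.e. `≤ ε` on `U` has
norm `≤ ε` everywhere on `U`: the superlevel set `U ∩ {ε < ‖f‖}` is open and Lebesgue-null, hence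
empty (Lebesgue measure charges nonempty open sets). [folklore] -/
theorem norm_le_of_ae_of_continuousOn {f : ℝ × ℝ³ → ℝ³} {U : Set (ℝ × ℝ³)} {ε : ℝ}
    (hU : IsOpen U) (hf : ContinuousOn f U)
    (h : ∀ᵐ z ∂(volume : Measure (ℝ × ℝ³)), z ∈ U → ‖f z‖ ≤ ε) :
    ∀ z ∈ U, ‖f z‖ ≤ ε := by
  intro z hz
  by_contra hle
  have hlt : ε < ‖f z‖ := not_le.1 hle
  have hO : IsOpen (U ∩ f ⁻¹' {v : ℝ³ | ε < ‖v‖}) :=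
    hf.isOpen_inter_preimage hU (isOpen_lt continuous_const continuous_norm)
  have hzero : volume (U ∩ f ⁻¹' {v : ℝ³ | ε < ‖v‖}) = 0 := by
    rw [measure_eq_zero_iff_ae_notMem]
    filter_upwards [h] with w hw hwO
    exact (not_lt.2 (hw hwO.1)) hwO.2
  exact (hO.measure_pos volume ⟨z, hz, hlt⟩).ne' hzero

/-! ## The scar, read on the continuous representatives -/

/-- **Same scar on continuous representatives.** If `V₁, V₂` are jointly smooth on the open slab,
agree a.e. there with `u₁, u₂`, and `u₁, u₂` have the same scar, then `V₁(s, x₀) − V₂(s, x₀) → 0` as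
`s ↑ 0`, for every `x₀ ≠ 0`: on `(−δ, 0) × B(x₀, ‖x₀‖/2)` the ess-sup smallness of `u₁ − u₂` is an
ess-sup smallness of the continuous `V₁ − V₂`, hence a pointwise one. [folklore] -/
theorem tendsto_sub_of_sameScar_ae {u₁ u₂ V₁ V₂ : ℝ → ℝ³ → ℝ³}
    (hV₁ : IsSmoothSpaceTimeOn (Iio (0 : ℝ)) V₁) (hV₂ : IsSmoothSpaceTimeOn (Iio (0 : ℝ)) V₂)
    (hae₁ : uncurry V₁ =ᵐ[volume.restrict (Iio (0 : ℝ) ×ˢ (univ : Set ℝ³))] uncurry u₁)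
    (hae₂ : uncurry V₂ =ᵐ[volume.restrict (Iio (0 : ℝ) ×ˢ (univ : Set ℝ³))] uncurry u₂)
    (hscar : SameScar u₁ u₂) {x₀ : ℝ³} (hx₀ : x₀ ≠ 0) :
    Tendsto (fun s => V₁ s x₀ - V₂ s x₀) (𝓝[<] 0) (𝓝 0) := by
  rw [NormedAddGroup.tendsto_nhds_zero]
  intro ε hε
  -- the compact piece `K = closedBall x₀ (‖x₀‖/2)` avoids the origin
  have hn : 0 < ‖x₀‖ := norm_pos_iff.2 hx₀
  have hr0 : 0 < ‖x₀‖ / 2 := half_pos hn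
  have hK : IsCompact (closedBall x₀ (‖x₀‖ / 2)) := isCompact_closedBall x₀ _
  have h0K : (0 : ℝ³) ∉ closedBall x₀ (‖x₀‖ / 2) := by
    intro h0
    rw [mem_closedBall, dist_comm, dist_zero_right] at h0
    linarith
  -- ess-sup smallness of `u₁ - u₂` on `(−δ, 0) × K` for a small `δ > 0`
  have hε2 : (0 : ℝ≥0∞) < ENNReal.ofReal (ε / 2) := ENNReal.ofReal_pos.2 (half_pos hε)
  obtain ⟨δ, hδ, hδ0⟩ : ∃ δ : ℝ, eLpNorm (uncurry u₁ - uncurry u₂) ⊤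
      (volume.restrict (Ioo (-δ) 0 ×ˢ closedBall x₀ (‖x₀‖ / 2))) ≤ ENNReal.ofReal (ε / 2) ∧
      δ ∈ Ioi (0 : ℝ) :=
    ((ENNReal.tendsto_nhds_zero.1 (hscar _ hK h0K) _ hε2).and eventually_mem_nhdsWithin).exists
  have hδ0' : (0 : ℝ) < δ := hδ0
  -- transfer to `V₁ - V₂` through the a.e. equalities on the slab
  have hsub : Ioo (-δ) 0 ×ˢ closedBall x₀ (‖x₀‖ / 2) ⊆ Iio (0 : ℝ) ×ˢ (univ : Set ℝ³) :=
    prod_mono Ioo_subset_Iio_self (subset_univ _)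
  have hae₁' : uncurry V₁ =ᵐ[volume.restrict (Ioo (-δ) 0 ×ˢ closedBall x₀ (‖x₀‖ / 2))] uncurry u₁ :=
    ae_restrict_of_ae_restrict_of_subset hsub hae₁
  have hae₂' : uncurry V₂ =ᵐ[volume.restrict (Ioo (-δ) 0 ×ˢ closedBall x₀ (‖x₀‖ / 2))] uncurry u₂ :=
    ae_restrict_of_ae_restrict_of_subset hsub hae₂
  have haeV : uncurry V₁ - uncurry V₂
      =ᵐ[volume.restrict (Ioo (-δ) 0 ×ˢ closedBall x₀ (‖x₀‖ / 2))] uncurry u₁ - uncurry u₂ :=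
    hae₁'.sub hae₂'
  rw [← eLpNorm_congr_ae haeV, eLpNorm_exponent_top] at hδ
  -- an a.e. pointwise bound on the closed box ...
  have hae' : ∀ᵐ z ∂(volume.restrict (Ioo (-δ) 0 ×ˢ closedBall x₀ (‖x₀‖ / 2))),
      ‖(uncurry V₁ - uncurry V₂) z‖ ≤ ε / 2 := by
    filter_upwards [ae_le_eLpNormEssSup (μ := volume.restrict (Ioo (-δ) 0 ×ˢ closedBall x₀ (‖x₀‖ / 2)))
      (f := uncurry V₁ - uncurry V₂)] with z hz
    rw [← ofReal_norm] at hz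
    exact (ENNReal.ofReal_le_ofReal_iff (half_pos hε).le).1 (hz.trans hδ)
  have hae := (ae_restrict_iff' (measurableSet_Ioo.prod measurableSet_closedBall)).1 hae'
  -- ... holds everywhere on the open box `(−δ, 0) × ball x₀ (‖x₀‖/2)`, by continuity
  have hU : IsOpen (Ioo (-δ) 0 ×ˢ ball x₀ (‖x₀‖ / 2)) := isOpen_Ioo.prod isOpen_ball
  have hcont : ContinuousOn (uncurry V₁ - uncurry V₂) (Ioo (-δ) 0 ×ˢ ball x₀ (‖x₀‖ / 2)) :=
    ((ContDiffOn.continuousOn hV₁).sub (ContDiffOn.continuousOn hV₂)).mono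
      (prod_mono Ioo_subset_Iio_self (subset_univ _))
  have hall := norm_le_of_ae_of_continuousOn hU hcont
    (hae.mono fun z hz hzU => hz ⟨hzU.1, ball_subset_closedBall hzU.2⟩)
  -- conclude along `s ↑ 0`
  filter_upwards [Ioo_mem_nhdsLT (neg_lt_zero.2 hδ0')] with s hs
  have h : ‖V₁ s x₀ - V₂ s x₀‖ ≤ ε / 2 := hall (s, x₀) ⟨hs, mem_ball_self hr0⟩
  exact h.trans_lt (half_lt_self hε)

/-! ## The stub -/

/-- **S1b — the scar makes the twins polynomially close off the apex.**  If `V₁, V₂` are jointly smooth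
representatives of `u₁, u₂` with `‖∂ₜVᵢ‖ ≤ Lᵢ/(‖x‖+√−t)³` and `u₁, u₂` have the same scar, then
`‖V₁(t,x) − V₂(t,x)‖ ≤ (L₁+L₂)(−t)/‖x‖³` for all `t < 0`, `x ≠ 0`: the continuous representatives agree in
the limit `t ↑ 0` at every `x ≠ 0` (ess-sup smallness on `(−δ,0) × K` plus continuity), and one integrates
the time derivative (mean value inequality on `(−∞, 0)` with the bound `(L₁+L₂)/‖x‖³`). [folklore] -/
theorem stub_farFieldOfScar :
    ∀ (u₁ u₂ V₁ V₂ : ℝ → ℝ³ → ℝ³) (L₁ L₂ : ℝ),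
      IsSmoothSpaceTimeOn (Iio (0 : ℝ)) V₁ → IsSmoothSpaceTimeOn (Iio (0 : ℝ)) V₂ →
      uncurry V₁ =ᵐ[volume.restrict (Iio (0 : ℝ) ×ˢ (univ : Set ℝ³))] uncurry u₁ →
      uncurry V₂ =ᵐ[volume.restrict (Iio (0 : ℝ) ×ˢ (univ : Set ℝ³))] uncurry u₂ →
      (∀ t < 0, ∀ x : ℝ³, ‖deriv (fun s => V₁ s x) t‖ ≤ L₁ / (‖x‖ + Real.sqrt (-t)) ^ 3) →
      (∀ t < 0, ∀ x : ℝ³, ‖deriv (fun s => V₂ s x) t‖ ≤ L₂ / (‖x‖ + Real.sqrt (-t)) ^ 3) →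
      SameScar u₁ u₂ →
      ∀ t < 0, ∀ x : ℝ³, x ≠ 0 → ‖V₁ t x - V₂ t x‖ ≤ (L₁ + L₂) * (-t) / ‖x‖ ^ 3 := by
  intro u₁ u₂ V₁ V₂ L₁ L₂ hV₁ hV₂ hae₁ hae₂ hd₁ hd₂ hscar t ht x hx
  -- positivity of the denominators and of `L₁ + L₂`
  have hρ : ∀ s < (0 : ℝ), 0 < ‖x‖ + Real.sqrt (-s) := fun s hs =>
    add_pos_of_nonneg_of_pos (norm_nonneg _) (Real.sqrt_pos.2 (neg_pos.2 hs))
  have hxpos : 0 < ‖x‖ := norm_pos_iff.2 hx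
  have hL : 0 ≤ L₁ + L₂ := by
    have hp : 0 < (‖x‖ + Real.sqrt (-t)) ^ 3 := pow_pos (hρ t ht) 3
    have h1 := mul_nonneg ((norm_nonneg _).trans (hd₁ t ht x)) hp.le
    have h2 := mul_nonneg ((norm_nonneg _).trans (hd₂ t ht x)) hp.le
    rw [div_mul_cancel₀ _ hp.ne'] at h1 h2
    linarith
  -- the time line `g s = V₁ s x - V₂ s x`: derivative within `Iio 0` and its bound on `s < 0`
  have hderiv : ∀ s ∈ Iio (0 : ℝ), HasDerivWithinAt (fun s => V₁ s x - V₂ s x)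
      (deriv (fun s => V₁ s x) s - deriv (fun s => V₂ s x) s) (Iio 0) s := by
    intro s hs
    have h1 : DifferentiableAt ℝ (fun s => V₁ s x) s :=
      (hV₁.differentiableWithinAt_time hs x).differentiableAt (isOpen_Iio.mem_nhds hs)
    have h2 : DifferentiableAt ℝ (fun s => V₂ s x) s :=
      (hV₂.differentiableWithinAt_time hs x).differentiableAt (isOpen_Iio.mem_nhds hs)
    exact (h1.hasDerivAt.sub h2.hasDerivAt).hasDerivWithinAt
  have hbound : ∀ s ∈ Iio (0 : ℝ),
      ‖deriv (fun s => V₁ s x) s - deriv (fun s => V₂ s x) s‖ ≤ (L₁ + L₂) / ‖x‖ ^ 3 := by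
    intro s hs
    have hs' : s < 0 := hs
    have hρ3 : ‖x‖ ^ 3 ≤ (‖x‖ + Real.sqrt (-s)) ^ 3 :=
      pow_le_pow_left₀ (norm_nonneg _) (le_add_of_nonneg_right (Real.sqrt_nonneg _)) 3
    calc ‖deriv (fun s => V₁ s x) s - deriv (fun s => V₂ s x) s‖
        ≤ ‖deriv (fun s => V₁ s x) s‖ + ‖deriv (fun s => V₂ s x) s‖ := norm_sub_le _ _
      _ ≤ L₁ / (‖x‖ + Real.sqrt (-s)) ^ 3 + L₂ / (‖x‖ + Real.sqrt (-s)) ^ 3 :=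
          add_le_add (hd₁ s hs' x) (hd₂ s hs' x)
      _ = (L₁ + L₂) / (‖x‖ + Real.sqrt (-s)) ^ 3 := (add_div _ _ _).symm
      _ ≤ (L₁ + L₂) / ‖x‖ ^ 3 := div_le_div_of_nonneg_left hL (pow_pos hxpos 3) hρ3
  -- mean value inequality on the convex set `Iio 0`
  have hmv : ∀ s ∈ Iio (0 : ℝ),
      ‖(V₁ s x - V₂ s x) - (V₁ t x - V₂ t x)‖ ≤ (L₁ + L₂) / ‖x‖ ^ 3 * ‖s - t‖ :=
    fun s hs => (convex_Iio (0 : ℝ)).norm_image_sub_le_of_norm_hasDerivWithin_le hderiv hbound ht hs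
  -- let `s ↑ 0`: the left side tends to `‖V₁ t x - V₂ t x‖`, the right side to `(L₁+L₂)/‖x‖³ · (−t)`
  have hg0 := tendsto_sub_of_sameScar_ae hV₁ hV₂ hae₁ hae₂ hscar hx
  have hlhs : Tendsto (fun s => ‖(V₁ s x - V₂ s x) - (V₁ t x - V₂ t x)‖) (𝓝[<] 0)
      (𝓝 ‖(0 : ℝ³) - (V₁ t x - V₂ t x)‖) :=
    (hg0.sub_const _).norm
  have hrhs : Tendsto (fun s : ℝ => (L₁ + L₂) / ‖x‖ ^ 3 * ‖s - t‖) (𝓝[<] 0)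
      (𝓝 ((L₁ + L₂) / ‖x‖ ^ 3 * ‖(0 : ℝ) - t‖)) :=
    ((tendsto_id.sub_const t).norm.const_mul _).mono_left nhdsWithin_le_nhds
  have hle := le_of_tendsto_of_tendsto hlhs hrhs (eventually_mem_nhdsWithin.mono hmv)
  simp only [zero_sub, norm_neg, Real.norm_eq_abs, abs_of_neg ht] at hle
  calc ‖V₁ t x - V₂ t x‖ ≤ (L₁ + L₂) / ‖x‖ ^ 3 * -t := hle
    _ = (L₁ + L₂) * (-t) / ‖x‖ ^ 3 := div_mul_eq_mul_div _ _ _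

end Summit.NavierStokesRegularity.NavierStokesRegularity.Theorems.RellichScarScarRigidity

end
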